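import Mathlib
import Summits.AtomisticToContinuum.Crystallization.Theorems.PricedLinkCensusTruncatedCensusGapNearShellGeometry

/-!
# First-shell extraction at a near-Barlow site

Helper file for the stub `stub_nearPricingEngine` (N3) of the line `near-far-split` of the crux
`PricedLinkCensus.TruncatedCensusGap` (item stmt-AtomisticToContinuum-14230), skeleton
`Cruxes/TruncatedCensusGap/Lines/near_far_split.lean`.

A site `i` of `y : Fin N → ℝ³` is near-Barlow with data `(a, c, s, g)` (`a ∈ [0.93, 1.02]`,
`c ∈ [0.78a, 0.86a]`, `s` Hägg, `g` a rigid motion) when its closed `3a`-patch is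
`a/2`-separated and two-way `a/50`-matched to `g '' barlowStacking a c s` (the predicate inlined
in the skeleton).  Using the first-shell classification on the near window
(`PricedLinkCensusTruncatedCensusGapNearShellGeometry`: the points of the stacking other than
`z₀` closer than `13a/10` to it are the twelve points at distance `a` or `√(a²/3 + c²) ≤ 1.036a`)
this file extracts the FIRST COORDINATION SHELL of a near site:

* `eq_of_matched_barlow`, `eq_of_matched_site` — matched stacking points / matched sites are
  unique (`a/25` is below both the discreteness `min a c ≥ 0.78a` of the stacking and the
  separation `a/2` of the patch);
* `nearBarlow_firstShell_out` — every site `j ≠ i` within `6a/5` of `y i` is `a/50`-close to the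
  image of a first-shell point of the stacking point `z₀` matched to `y i`, hence within
  `11a/10` of `y i` (the annulus `(11a/10, 6a/5]` is empty);
* `nearBarlow_firstShell_in` — every first-shell point of `z₀` carries exactly one site, which
  is not `i` and lies within `11a/10` of `y i`;
* `nearBarlow_card_firstShell` (`'`) — hence exactly twelve sites `j ≠ i` within `11a/10`
  (resp. `6a/5`) of `y i`;
* `nearBarlow_firstShell` — the registered one-line form.

Only `0 < a` and the spacing window are used (not `a ∈ [0.93, 1.02]`).
-/

noncomputable section

namespace Summit.AtomisticToContinuum.Crystallization.Theorems.PricedLinkCensusTruncatedCensusGap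

open scoped BigOperators Classical
open Literature.MathematicalPhysics.StatisticalMechanics

section Extraction

variable {N : ℕ} {y : Fin N → EuclideanSpace ℝ (Fin 3)} {i : Fin N} {a c : ℝ} {s : ℤ → ℤ}
  {g : EuclideanSpace ℝ (Fin 3) ≃ᵃⁱ[ℝ] EuclideanSpace ℝ (Fin 3)}

/-- **Matched stacking points are unique**: two points of the stacking both `a/50`-close (after
the rigid motion `g`) to the same point coincide (`a/25 < 0.78a ≤ min a c`, the uniform
discreteness `le_dist_of_mem_barlowStacking`). [folklore] -/
theorem eq_of_matched_barlow (ha : 0 < a) (hc1 : 78 / 100 * a ≤ c)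
    {z z' : EuclideanSpace ℝ (Fin 3)} (hz : z ∈ barlowStacking a c s)
    (hz' : z' ∈ barlowStacking a c s) {p : EuclideanSpace ℝ (Fin 3)}
    (hp : dist p (g z) ≤ a / 50) (hp' : dist p (g z') ≤ a / 50) : z = z' := by
  by_contra hne
  have h1 : min a c ≤ dist z z' :=
    le_dist_of_mem_barlowStacking a c s ha.le (by linarith) hz hz' hne
  have h2 : 78 / 100 * a ≤ min a c := le_min (by linarith) hc1
  have h3 : dist z z' ≤ dist p (g z) + dist p (g z') := by
    rw [← g.dist_map, dist_comm p (g z)]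
    exact dist_triangle _ _ _
  linarith

/-- **Matched sites are unique**: two sites of the `3a`-patch both `a/50`-close to the same point
coincide (`a/25 < a/2`, the separation clause). [folklore] -/
theorem eq_of_matched_site (ha : 0 < a)
    (hsep : ∀ j k : Fin N, j ≠ k → dist (y j) (y i) ≤ 3 * a → a / 2 ≤ dist (y j) (y k))
    {j j' : Fin N} (hj3 : dist (y j) (y i) ≤ 3 * a) {q : EuclideanSpace ℝ (Fin 3)}
    (hjq : dist (y j) q ≤ a / 50) (hj'q : dist (y j') q ≤ a / 50) : j' = j := by
  by_contra hne
  have h1 := hsep j j' (Ne.symm hne) hj3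
  have h2 : dist (y j) (y j') ≤ dist (y j) q + dist (y j') q := by
    rw [dist_comm (y j') q]
    exact dist_triangle _ _ _
  linarith

/-- **First-shell extraction, outward.** Let the site `i` carry near-Barlow data
`(a, c, s, g)` (`0 < a`, `0.78a ≤ c ≤ 0.86a`, `s` Hägg; separation and forward matching within
`3a`), and let `z₀` be the stacking point matched to `y i`.  Then every other site `j` within
`6a/5` of `y i` is `a/50`-close to the `g`-image of a FIRST-SHELL point `z` of `z₀`
(`dist z z₀ = a`, in layer, or `= √(a²/3 + c²)`, adjacent layer), and consequently lies within
`11a/10` of `y i` (the annulus `11a/10 < dist ≤ 6a/5` about a near site is empty). [folklore] -/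
theorem nearBarlow_firstShell_out (ha : 0 < a) (hc1 : 78 / 100 * a ≤ c) (hc2 : c ≤ 86 / 100 * a)
    (hs : IsHaggSeq s)
    (hsep : ∀ j k : Fin N, j ≠ k → dist (y j) (y i) ≤ 3 * a → a / 2 ≤ dist (y j) (y k))
    (hfwd : ∀ j : Fin N, dist (y j) (y i) ≤ 3 * a →
      ∃ z ∈ barlowStacking a c s, dist (y j) (g z) ≤ a / 50)
    {z₀ : EuclideanSpace ℝ (Fin 3)} (hz₀ : z₀ ∈ barlowStacking a c s)
    (hiz₀ : dist (y i) (g z₀) ≤ a / 50) {j : Fin N} (hji : j ≠ i)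
    (hj : dist (y j) (y i) ≤ 6 / 5 * a) :
    ∃ z ∈ barlowStacking a c s, dist (y j) (g z) ≤ a / 50 ∧
      (dist z z₀ = a ∨ dist z z₀ = Real.sqrt (a ^ 2 / 3 + c ^ 2)) ∧
      dist (y j) (y i) ≤ 11 / 10 * a := by
  obtain ⟨z, hz, hjz⟩ := hfwd j (by linarith)
  have hsepji : a / 2 ≤ dist (y j) (y i) := hsep j i hji (by linarith)
  have hgz : dist z z₀ = dist (g z) (g z₀) := (g.dist_map z z₀).symm
  have ht1 : dist (g z) (g z₀) ≤ dist (g z) (y j) + dist (y j) (y i) + dist (y i) (g z₀) :=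
    dist_triangle4 _ _ _ _
  have ht2 : dist (y j) (y i) ≤ dist (y j) (g z) + dist (g z) (g z₀) + dist (g z₀) (y i) :=
    dist_triangle4 _ _ _ _
  rw [dist_comm (g z) (y j)] at ht1
  rw [dist_comm (g z₀) (y i)] at ht2
  have hne : z ≠ z₀ := by
    rintro rfl
    rw [dist_self] at ht2
    linarith
  have hlt : dist z z₀ < 13 / 10 * a := by rw [hgz]; linarith
  have hshell : dist z z₀ = a ∨ dist z z₀ = Real.sqrt (a ^ 2 / 3 + c ^ 2) := by
    obtain ⟨k, i', j', rfl⟩ := hz₀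
    obtain ⟨k', i'', j'', rfl⟩ := hz
    exact dist_eq_or_of_wideShell hs ha hc1 hc2 hne hlt
  have hdz : dist z z₀ ≤ 53 / 50 * a := by
    rcases hshell with h | h
    · rw [h]; linarith
    · rw [h]; exact (sqrt_shell_bounds ha hc1 hc2).2
  rw [hgz] at hdz
  exact ⟨z, hz, hjz, hshell, by linarith⟩

/-- **First-shell extraction, inward.** With the same data plus backward matching within `3a`,
every first-shell point `z` of `z₀` has exactly one site `a/50`-close to its `g`-image, and that
site is not `i` and lies within `11a/10` of `y i`. [folklore] -/
theorem nearBarlow_firstShell_in (ha : 0 < a) (hc1 : 78 / 100 * a ≤ c) (hc2 : c ≤ 86 / 100 * a)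
    (hsep : ∀ j k : Fin N, j ≠ k → dist (y j) (y i) ≤ 3 * a → a / 2 ≤ dist (y j) (y k))
    (hbwd : ∀ z ∈ barlowStacking a c s, dist (g z) (y i) ≤ 3 * a →
      ∃ j : Fin N, dist (y j) (g z) ≤ a / 50)
    {z₀ : EuclideanSpace ℝ (Fin 3)} (hiz₀ : dist (y i) (g z₀) ≤ a / 50)
    {z : EuclideanSpace ℝ (Fin 3)} (hz : z ∈ barlowStacking a c s)
    (hshell : dist z z₀ = a ∨ dist z z₀ = Real.sqrt (a ^ 2 / 3 + c ^ 2)) :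
    ∃ j : Fin N, j ≠ i ∧ dist (y j) (g z) ≤ a / 50 ∧ dist (y j) (y i) ≤ 11 / 10 * a ∧
      ∀ j' : Fin N, dist (y j') (g z) ≤ a / 50 → j' = j := by
  obtain ⟨hlo, hhi⟩ := sqrt_shell_bounds ha hc1 hc2
  have hdz : dist z z₀ ≤ 53 / 50 * a := by rcases hshell with h | h <;> rw [h] <;> linarith
  have hdz' : a / 2 < dist z z₀ := by rcases hshell with h | h <;> rw [h] <;> linarith
  rw [← g.dist_map] at hdz hdz'
  have hzi : dist (g z) (y i) ≤ 54 / 50 * a := by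
    linarith [dist_triangle (g z) (g z₀) (y i), dist_comm (g z₀) (y i)]
  obtain ⟨j, hj⟩ := hbwd z hz (by linarith)
  have hji3 : dist (y j) (y i) ≤ 11 / 10 * a := by linarith [dist_triangle (y j) (g z) (y i)]
  refine ⟨j, ?_, hj, hji3, fun j' hj' => ?_⟩
  · rintro rfl
    linarith [dist_triangle (g z) (y j) (g z₀), dist_comm (g z) (y j)]
  · exact eq_of_matched_site ha hsep (by linarith) hj hj'

/-- **A near site has exactly twelve neighbours within `11a/10`.** With the near-Barlow data at
`i` (separation, forward and backward matching within `3a`) and `z₀` the stacking point matched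
to `y i`, the sites `j ≠ i` within `11a/10` of `y i` are in bijection with the twelve first-shell
points of `z₀` (`j ↦` the stacking point matched to `y j`). [folklore] -/
theorem nearBarlow_card_firstShell (ha : 0 < a) (hc1 : 78 / 100 * a ≤ c) (hc2 : c ≤ 86 / 100 * a)
    (hs : IsHaggSeq s)
    (hsep : ∀ j k : Fin N, j ≠ k → dist (y j) (y i) ≤ 3 * a → a / 2 ≤ dist (y j) (y k))
    (hfwd : ∀ j : Fin N, dist (y j) (y i) ≤ 3 * a →
      ∃ z ∈ barlowStacking a c s, dist (y j) (g z) ≤ a / 50)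
    (hbwd : ∀ z ∈ barlowStacking a c s, dist (g z) (y i) ≤ 3 * a →
      ∃ j : Fin N, dist (y j) (g z) ≤ a / 50)
    {z₀ : EuclideanSpace ℝ (Fin 3)} (hz₀ : z₀ ∈ barlowStacking a c s)
    (hiz₀ : dist (y i) (g z₀) ≤ a / 50) :
    (Finset.univ.filter fun j : Fin N => j ≠ i ∧ dist (y j) (y i) ≤ 11 / 10 * a).card = 12 := by
  set S := Finset.univ.filter fun j : Fin N => j ≠ i ∧ dist (y j) (y i) ≤ 11 / 10 * a with hS
  set FS : Set (EuclideanSpace ℝ (Fin 3)) := {z | z ∈ barlowStacking a c s ∧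
      (dist z z₀ = a ∨ dist z z₀ = Real.sqrt (a ^ 2 / 3 + c ^ 2))} with hFS
  have hFS12 : FS.ncard = 12 := (barlowWideWindowShell a c s ha hc1 hc2 hs z₀ hz₀).2
  have hFSfin : FS.Finite := Set.finite_of_ncard_ne_zero (by rw [hFS12]; norm_num)
  have hmemS : ∀ {j}, j ∈ S ↔ j ≠ i ∧ dist (y j) (y i) ≤ 11 / 10 * a := fun {j} => by
    simp [hS]
  -- outward map `S → FS`
  have hout : ∀ j, j ∈ S → ∃ z ∈ FS, dist (y j) (g z) ≤ a / 50 := by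
    intro j hj
    obtain ⟨hji, hd⟩ := hmemS.1 hj
    obtain ⟨z, hz, hjz, hshell, -⟩ :=
      nearBarlow_firstShell_out ha hc1 hc2 hs hsep hfwd hz₀ hiz₀ hji (by linarith)
    exact ⟨z, ⟨hz, hshell⟩, hjz⟩
  choose! φ hφFS hφd using hout
  have hle : S.card ≤ 12 := by
    rw [← hFS12, ← Set.ncard_coe_finset]
    refine Set.ncard_le_ncard_of_injOn φ (fun j hj => hφFS j hj) ?_ hFSfin
    intro j hj j' hj' hjj'
    have h1 := hφd j hj
    have h2 := hφd j' hj'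
    rw [← hjj'] at h2
    exact (eq_of_matched_site ha hsep (by linarith [(hmemS.1 hj).2]) h1 h2).symm
  -- inward map `FS → S`
  have hin : ∀ z, z ∈ FS → ∃ j ∈ (S : Set (Fin N)), dist (y j) (g z) ≤ a / 50 := by
    rintro z ⟨hz, hshell⟩
    obtain ⟨j, hji, hjz, hd, -⟩ := nearBarlow_firstShell_in ha hc1 hc2 hsep hbwd hiz₀ hz hshell
    exact ⟨j, hmemS.2 ⟨hji, hd⟩, hjz⟩
  haveI : Nonempty (Fin N) := ⟨i⟩
  choose! ψ hψS hψd using hin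
  have hge : 12 ≤ S.card := by
    rw [← hFS12, ← Set.ncard_coe_finset]
    refine Set.ncard_le_ncard_of_injOn ψ (fun z hz => hψS z hz) ?_ S.finite_toSet
    intro z hz z' hz' hzz'
    have h1 := hψd z hz
    have h2 := hψd z' hz'
    rw [← hzz'] at h2
    exact eq_of_matched_barlow ha hc1 hz.1 hz'.1 h1 h2
  omega

/-- The same count at radius `6a/5` (the annulus up to `6a/5` is empty). [folklore] -/
theorem nearBarlow_card_firstShell' (ha : 0 < a) (hc1 : 78 / 100 * a ≤ c) (hc2 : c ≤ 86 / 100 * a)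
    (hs : IsHaggSeq s)
    (hsep : ∀ j k : Fin N, j ≠ k → dist (y j) (y i) ≤ 3 * a → a / 2 ≤ dist (y j) (y k))
    (hfwd : ∀ j : Fin N, dist (y j) (y i) ≤ 3 * a →
      ∃ z ∈ barlowStacking a c s, dist (y j) (g z) ≤ a / 50)
    (hbwd : ∀ z ∈ barlowStacking a c s, dist (g z) (y i) ≤ 3 * a →
      ∃ j : Fin N, dist (y j) (g z) ≤ a / 50)
    {z₀ : EuclideanSpace ℝ (Fin 3)} (hz₀ : z₀ ∈ barlowStacking a c s)
    (hiz₀ : dist (y i) (g z₀) ≤ a / 50) :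
    (Finset.univ.filter fun j : Fin N => j ≠ i ∧ dist (y j) (y i) ≤ 6 / 5 * a).card = 12 := by
  rw [← nearBarlow_card_firstShell ha hc1 hc2 hs hsep hfwd hbwd hz₀ hiz₀]
  congr 1
  ext j
  simp only [Finset.mem_filter, Finset.mem_univ, true_and]
  refine ⟨fun ⟨hji, hd⟩ => ⟨hji, ?_⟩, fun ⟨hji, hd⟩ => ⟨hji, by linarith⟩⟩
  obtain ⟨-, -, -, -, h⟩ := nearBarlow_firstShell_out ha hc1 hc2 hs hsep hfwd hz₀ hiz₀ hji hd
  exact h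

end Extraction

/-- **First-shell extraction at a near-Barlow site (registered form).** If the site `i` of `y : Fin N → ℝ³` carries near-Barlow data `(a, c, s, g)` — `0 < a`, `0.78a ≤ c ≤ 0.86a`, `s` Hägg, the `3a`-patch `a/2`-separated and two-way `a/50`-matched to `g '' barlowStacking a c s` — then for the stacking point `z₀` matched to `y i`: every other site within `6a/5` of `y i` is `a/50`-close to the image of a first-shell point of `z₀` (at distance `a` or `√(a²/3 + c²)` from `z₀`) and lies within `11a/10`; every first-shell point carries exactly one site, not `i`, within `11a/10` of `y i`; and the sites other than `i` within `11a/10` of `y i` number exactly twelve. [folklore] -/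
theorem nearBarlow_firstShell : ∀ (N : ℕ) (y : Fin N → EuclideanSpace ℝ (Fin 3)) (i : Fin N) (a c : ℝ) (s : ℤ → ℤ) (g : EuclideanSpace ℝ (Fin 3) ≃ᵃⁱ[ℝ] EuclideanSpace ℝ (Fin 3)), 0 < a → 78 / 100 * a ≤ c → c ≤ 86 / 100 * a → Literature.MathematicalPhysics.StatisticalMechanics.IsHaggSeq s → (∀ j k : Fin N, j ≠ k → dist (y j) (y i) ≤ 3 * a → a / 2 ≤ dist (y j) (y k)) → (∀ j : Fin N, dist (y j) (y i) ≤ 3 * a → ∃ z ∈ Literature.MathematicalPhysics.StatisticalMechanics.barlowStacking a c s, dist (y j) (g z) ≤ a / 50) → (∀ z ∈ Literature.MathematicalPhysics.StatisticalMechanics.barlowStacking a c s, dist (g z) (y i) ≤ 3 * a → ∃ j : Fin N, dist (y j) (g z) ≤ a / 50) → ∃ z₀ ∈ Literature.MathematicalPhysics.StatisticalMechanics.barlowStacking a c s, dist (y i) (g z₀) ≤ a / 50 ∧ (∀ j : Fin N, j ≠ i → dist (y j) (y i) ≤ 6 / 5 * a → ∃ z ∈ Literature.MathematicalPhysics.StatisticalMechanics.barlowStacking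 a c s, dist (y j) (g z) ≤ a / 50 ∧ (dist z z₀ = a ∨ dist z z₀ = Real.sqrt (a ^ 2 / 3 + c ^ 2)) ∧ dist (y j) (y i) ≤ 11 / 10 * a) ∧ (∀ z ∈ Literature.MathematicalPhysics.StatisticalMechanics.barlowStacking a c s, (dist z z₀ = a ∨ dist z z₀ = Real.sqrt (a ^ 2 / 3 + c ^ 2)) → ∃ j : Fin N, j ≠ i ∧ dist (y j) (g z) ≤ a / 50 ∧ dist (y j) (y i) ≤ 11 / 10 * a ∧ ∀ j' : Fin N, dist (y j') (g z) ≤ a / 50 → j' = j) ∧ Nat.card {j : Fin N // j ≠ i ∧ dist (y j) (y i) ≤ 11 / 10 * a} = 12 := by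
  intro N y i a c s g ha hc1 hc2 hs hsep hfwd hbwd
  obtain ⟨z₀, hz₀, hiz₀⟩ := hfwd i (by rw [dist_self]; positivity)
  refine ⟨z₀, hz₀, hiz₀, fun j hji hj => nearBarlow_firstShell_out ha hc1 hc2 hs hsep hfwd hz₀ hiz₀ hji hj, fun z hz hshell => nearBarlow_firstShell_in ha hc1 hc2 hsep hbwd hiz₀ hz hshell, ?_⟩
  rw [Nat.card_eq_fintype_card, Fintype.card_subtype]
  exact nearBarlow_card_firstShell ha hc1 hc2 hs hsep hfwd hbwd hz₀ hiz₀

end Summit.AtomisticToContinuum.Crystallization.Theorems.PricedLinkCensusTruncatedCensusGap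

end
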